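import Summits.Ventures.LatticeQCDFlow.Scaling.AllocationCostLaw
import Summits.Ventures.LatticeQCDFlow.Scaling.OneSidedHubCorollaries

/-!
HONEST FRAMING: exact (Metropolis-corrected) sampling algorithms for lattice gauge theory; figures
of merit are autocorrelation/cost numbers at stated couplings and volumes; no continuum-physics
claim.

# StarBeatsDenseGraphs — THE PLAIN STAR OUT-RELAXES EVERY DENSE SWAP GRAPH: ONCE `m·p·v·min{t, γ₀(1−t)} ≥ 7K·t`,
# EVERY SIMPLE SWAP GRAPH WITH `m` EDGES — ANY SECTOR-PRESERVING MAPS, ANY ALLOCATION OF THE UPDATES OVER SECTOR-IDLE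
# COLD REPLICAS — HAS `Gap ≤ Gap(hot-only star)`; IN PARTICULAR THE COMPLETE GRAPH LOSES TO THE STAR AS SOON AS
# `(K+1)·p·v·min{t, γ₀(1−t)} ≥ 14t` (lean-2 GEN-23, ours)

Venture-side (OURS).  Cell `lqcd-flow` (pub-lqcd), unit `pub-lqcd-lean-2-g23`, 2026-08-26.  Chapter K, file 10: the
comparison theorem of the chapter, in the format of `Scaling/HubBeatsLadder` (J14).  Left side: any simple edge list
`e` of `m` entries (distinct endpoints, no repeated pair), sector-preserving maps `φ_r(A) = A`, any update allocation
`w` with sector-idle cold replicas (`w_k·Q_k(A,Aᶜ) = 0`, `k ≠ 0`), `μ_k(A)μ_k(Aᶜ) ≥ v > 0` for `k ≠ 0` — ceiling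
`t·min{μ_0(A),μ_0(Aᶜ)}/(m·v) ≤ t/(2m·v)` (`Scaling/SwapGraphDilution`, K1).  Right side: the hot-only star with
identity maps under one-sided domination `p·μ_{k+1} ≤ μ_0` and hot Poincaré constant `γ₀` — floor
`p·min{t, γ₀(1−t)}/(14K)` (`Scaling/OneSidedHubFloor`, J8).

## What is proved

* `dense_ceiling_le_star_floor` — the crossover arithmetic `14K·t ≤ 2m·p·v·min{t,γ₀(1−t)} ⇒ t/(2mv) ≤ p·min{t,γ₀(1−t)}/(14K)`.
* **`star_beats_denseGraph`** — under `2·m·p·v·min{t, γ₀(1−t)} ≥ 14K·t`: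
  `Gap(t·ptGraphSwap μ e φ + (1−t)·prodKernel w M) ≤ Gap(hot-only star)`.
* **`star_beats_completeGraph`** — `2m = K(K+1)` and `(K+1)·p·v·min{t, γ₀(1−t)} ≥ 14t` ⇒ the same: exchanging
  "any two replicas" is provably slower than exchanging only with the hot one, for every number of replicas beyond
  a constant.

Reading (no numerics implied): with one tunnelling replica, every edge that does not touch it is a wasted proposal;
past `m ≈ 7K·t/(p·v·min{t,γ₀(1−t)})` edges the waste alone makes the scheme slower than the bare star, whatever maps
or update schedule decorate it.  NOT CLAIMED: graphs with repeated hub entries (proposal laws: `Scaling/HubProposalLaw`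
shows the uniform star is optimal among those up to the constant); cold replicas relaxing within sectors; continuous
spaces; anything measured.  Literature grade (cell rule): OWN COMPOSITION (K1 + J8); nothing cited as a fact; no new
bib keys.
-/

noncomputable section

open Finset Function
open Literature.Probability.MarkovChains

namespace Summit.Ventures.LatticeQCDFlow.Scaling

variable {S : Type*} [Fintype S] [DecidableEq S] {K m : ℕ} {μ : Fin (K + 1) → S → ℝ}
  {M : Fin (K + 1) → S → S → ℝ} {w : Fin (K + 1) → ℝ} {t : ℝ} {e : Fin m → Fin (K + 1) × Fin (K + 1)}
  {φ : Fin m → Equiv.Perm S}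

omit [Fintype S] [DecidableEq S] in
/-- The crossover arithmetic: `14K·t ≤ 2m·(p·v·μ₀)` gives `t/(2mv) ≤ p·μ₀/(14K)` (`K, m, v > 0`). [ours] -/
theorem dense_ceiling_le_star_floor {p v μ₀ : ℝ} (hK : 0 < (K : ℝ)) (hm : 0 < (m : ℝ)) (hv : 0 < v)
    (hcross : 14 * K * t ≤ 2 * m * (p * v * μ₀)) :
    t / (2 * m * v) ≤ p * μ₀ / (14 * K) := by
  rw [div_le_div_iff₀ (by positivity) (by positivity)]
  calc t * (14 * K) = 14 * K * t := by ring
    _ ≤ 2 * m * (p * v * μ₀) := hcross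
    _ = p * μ₀ * (2 * m * v) := by ring

/-- **THE PLAIN STAR OUT-RELAXES EVERY DENSE SIMPLE SWAP GRAPH:** if `2·m·p·v·min{t, γ₀(1−t)} ≥ 14K·t`, then for every
simple edge list of `m` entries, every sector-preserving maps and every update allocation over sector-idle cold
replicas, `Gap(t·ptGraphSwap μ e φ + (1−t)·prodKernel w M) ≤ Gap(hot-only star)` (`K, m ≥ 1`, `0 < t < 1`, `|S| ≥ 2`;
star: one-sided domination `p·μ_{k+1} ≤ μ_0`, hot Poincaré constant `γ₀`). [ours] -/
theorem star_beats_denseGraph [Nontrivial S] (hK : 1 ≤ K) (hm : 1 ≤ m) (he : ∀ r, (e r).1 ≠ (e r).2)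
    (hsimple : Function.Injective (fun r => ({(e r).1, (e r).2} : Finset (Fin (K + 1)))))
    (hμ : ∀ k x, 0 < μ k x) (hμ1 : ∀ k, ∑ u, μ k u = 1) (hM : ∀ k, IsRowStochastic (M k))
    (hMrev : ∀ k, DetailedBalance (μ k) (M k)) (hw0 : ∀ k, 0 ≤ w k) (hw1 : ∑ k, w k = 1) (ht0 : 0 < t)
    (ht1 : t < 1) {p γ₀ : ℝ} (hp : 0 < p) (hp1 : p ≤ 1) (hγ₀ : 0 < γ₀)
    (hdom : ∀ (k : Fin K) (u : S), p * μ k.succ u ≤ μ 0 u)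
    (hgap0 : ∀ h : S → ℝ, γ₀ * lawVariance (μ 0) h ≤ dirichletForm (μ 0) (M 0) h) {A : Finset S}
    (hφA : ∀ r u, φ r u ∈ A ↔ u ∈ A) {v : ℝ} (hvpos : 0 < v)
    (hv : ∀ k : Fin (K + 1), k ≠ 0 → v ≤ (∑ u ∈ A, μ k u) * ∑ u ∈ Aᶜ, μ k u)
    (hidle : ∀ k : Fin (K + 1), k ≠ 0 → w k * edgeMeasure (μ k) (M k) A Aᶜ = 0)
    (hcross : 14 * K * t ≤ 2 * m * (p * v * min t (γ₀ * (1 - t)))) :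
    spectralGap (tensorFun μ) (fun x y : Fin (K + 1) → S => t * ptGraphSwap μ e φ x y + (1 - t) * prodKernel w M x y)
      ≤ spectralGap (tensorFun μ) (fun x y : Fin (K + 1) → S =>
          t * ptGraphSwap μ (fun k : Fin K => ((0 : Fin (K + 1)), k.succ)) (fun _ : Fin K => Equiv.refl S) x y
            + (1 - t) * prodKernel (fun k : Fin (K + 1) => if k = 0 then (1 : ℝ) else 0) M x y) := by
  have hKpos : (0 : ℝ) < K := Nat.cast_pos.mpr (by omega)
  have hmpos : (0 : ℝ) < m := Nat.cast_pos.mpr (by omega)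
  have hgraph := simpleGraph_spectralGap_le hK hm he hsimple hμ hμ1 hM hMrev hw0 hw1 ht0.le ht1.le hφA hvpos hv hidle
  have hstar := oneSidedHotOnlyStar_spectralGap_ge_linear (M := M) hK hμ hμ1 hM hMrev ht0 ht1 hp hp1 hγ₀ hdom hgap0
  have hmin : min (∑ u ∈ A, μ 0 u) (∑ u ∈ Aᶜ, μ 0 u) ≤ 1 / 2 := by
    have hsum : ∑ u ∈ A, μ 0 u + ∑ u ∈ Aᶜ, μ 0 u = 1 := by rw [Finset.sum_add_sum_compl, hμ1 0]
    rcases le_total (∑ u ∈ A, μ 0 u) (∑ u ∈ Aᶜ, μ 0 u) with hle | hle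
    · rw [min_eq_left hle]; linarith
    · rw [min_eq_right hle]; linarith
  have hhalf : t * min (∑ u ∈ A, μ 0 u) (∑ u ∈ Aᶜ, μ 0 u) / (m * v) ≤ t / (2 * m * v) := by
    rw [div_le_div_iff₀ (by positivity) (by positivity)]
    have := mul_le_mul_of_nonneg_left hmin ht0.le
    calc t * min (∑ u ∈ A, μ 0 u) (∑ u ∈ Aᶜ, μ 0 u) * (2 * m * v)
        = 2 * (m * v) * (t * min (∑ u ∈ A, μ 0 u) (∑ u ∈ Aᶜ, μ 0 u)) := by ring
      _ ≤ 2 * (m * v) * (t * (1 / 2)) := mul_le_mul_of_nonneg_left this (by positivity)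
      _ = t * (m * v) := by ring
  have hx := dense_ceiling_le_star_floor (μ₀ := min t (γ₀ * (1 - t))) hKpos hmpos hvpos hcross
  calc _ ≤ t * min (∑ u ∈ A, μ 0 u) (∑ u ∈ Aᶜ, μ 0 u) / (m * v) := hgraph
    _ ≤ t / (2 * m * v) := hhalf
    _ ≤ p * min t (γ₀ * (1 - t)) / (14 * K) := hx
    _ ≤ _ := hstar

/-- **THE COMPLETE GRAPH LOSES TO THE STAR** as soon as `(K+1)·p·v·min{t, γ₀(1−t)} ≥ 14t`: for a simple edge list
with `2m = K(K+1)` entries (every pair once), every sector-preserving maps and every update allocation over sector-idle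
cold replicas, `Gap ≤ Gap(hot-only star)`. [ours] -/
theorem star_beats_completeGraph [Nontrivial S] (hK : 1 ≤ K) (hm2 : 2 * m = K * (K + 1))
    (he : ∀ r, (e r).1 ≠ (e r).2)
    (hsimple : Function.Injective (fun r => ({(e r).1, (e r).2} : Finset (Fin (K + 1)))))
    (hμ : ∀ k x, 0 < μ k x) (hμ1 : ∀ k, ∑ u, μ k u = 1) (hM : ∀ k, IsRowStochastic (M k))
    (hMrev : ∀ k, DetailedBalance (μ k) (M k)) (hw0 : ∀ k, 0 ≤ w k) (hw1 : ∑ k, w k = 1) (ht0 : 0 < t)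
    (ht1 : t < 1) {p γ₀ : ℝ} (hp : 0 < p) (hp1 : p ≤ 1) (hγ₀ : 0 < γ₀)
    (hdom : ∀ (k : Fin K) (u : S), p * μ k.succ u ≤ μ 0 u)
    (hgap0 : ∀ h : S → ℝ, γ₀ * lawVariance (μ 0) h ≤ dirichletForm (μ 0) (M 0) h) {A : Finset S}
    (hφA : ∀ r u, φ r u ∈ A ↔ u ∈ A) {v : ℝ} (hvpos : 0 < v)
    (hv : ∀ k : Fin (K + 1), k ≠ 0 → v ≤ (∑ u ∈ A, μ k u) * ∑ u ∈ Aᶜ, μ k u)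
    (hidle : ∀ k : Fin (K + 1), k ≠ 0 → w k * edgeMeasure (μ k) (M k) A Aᶜ = 0)
    (hcross : 14 * t ≤ ((K : ℝ) + 1) * (p * v * min t (γ₀ * (1 - t)))) :
    spectralGap (tensorFun μ) (fun x y : Fin (K + 1) → S => t * ptGraphSwap μ e φ x y + (1 - t) * prodKernel w M x y)
      ≤ spectralGap (tensorFun μ) (fun x y : Fin (K + 1) → S =>
          t * ptGraphSwap μ (fun k : Fin K => ((0 : Fin (K + 1)), k.succ)) (fun _ : Fin K => Equiv.refl S) x y
            + (1 - t) * prodKernel (fun k : Fin (K + 1) => if k = 0 then (1 : ℝ) else 0) M x y) := by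
  have hKpos : (0 : ℝ) < K := Nat.cast_pos.mpr (by omega)
  have hm : 1 ≤ m := by
    rcases Nat.eq_zero_or_pos m with h | h
    · subst h; nlinarith
    · exact h
  have hmr : (2 : ℝ) * m = K * (K + 1) := by exact_mod_cast hm2
  refine star_beats_denseGraph hK hm he hsimple hμ hμ1 hM hMrev hw0 hw1 ht0 ht1 hp hp1 hγ₀ hdom hgap0 hφA hvpos hv
    hidle ?_
  calc 14 * (K : ℝ) * t = K * (14 * t) := by ring
    _ ≤ K * (((K : ℝ) + 1) * (p * v * min t (γ₀ * (1 - t)))) := mul_le_mul_of_nonneg_left hcross hKpos.le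
    _ = 2 * m * (p * v * min t (γ₀ * (1 - t))) := by rw [hmr]; ring

end Summit.Ventures.LatticeQCDFlow.Scaling

end
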